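import Summits.ABC.IUTFork.LDHPerPrimeReadingWitness
import HarnessLib

/-!
# The fork at [IUTchIII] Corollary 3.12, L-DH level: the CLAIM-form `Cor312Of` FAILS for a synthetic genuine-completion input

Record-only file (D-0012) of the abc-iut cell (WAVE-5 prover abc-iut-w5-d157); TAKES NO SIDE on Cor. 3.12. Sequel to
`LDHPerPrimeReading.lean` / `LDHPerPrimeReadingWitness.lean`. abc-iut-S2's `ThetaVolumeInput.Cor312Of I` ("`−|log(q)| ≤ −|log(Θ)|`",
both sides the DEFINED Haar log-volumes over the genuine completions `K_{v̲}`; `GenuineLogTheta.lean`) is the cell's CLAIM form of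
Dupuy–Hilado (1.1) / [IUTchIII] Cor. 3.12 for a Θ-volume input. THIS FILE: it is NOT a consequence of the volume formalism — for the
SYNTHETIC input `ThetaVolumeInput.deepAt p l N σ` over a degree-one base (`j_E := p^{−2lN}`, `S := V(F₀)_p`, ideles := powers of `p`;
`LDHPerPrimeReadingWitness`) and `N` large, `Cor312Of` is FALSE (`ThetaVolumeInput.exists_deepAt_not_cor312Of`): the Θ-side at `p` is
`≤ −c_l·N·e·ln N(v₀) + D_p` (`c_l = (ℓ⋆+1)(2ℓ⋆+1)/6 ≥ 5/2`; `DHData.negLogThetaLoc_le` + `explicitDeltaAt_le_of_subsingleton`), every other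
support prime `p'` (the prime factors of `2·|disc K|`, an `N`-FREE set) contributes at most its `ord(q)`-free `D_{p'}` (its `q`-mass is `0`),
the archimedean summand is the constant `((l+5)/4)·log π`, while the `q`-side is `−N·e·ln N(v₀)` — so (1.1) would force
`(c_l − 1)·N·e·ln N(v₀) ≤ Σ_{p'} D_{p'} + ((l+5)/4)·log π`, false for large `N` (the synthetic input has ONE deep bad prime and NO
compensating conductor: the abc balance that an actual elliptic curve would supply is absent by construction).
READING: any derivation of (1.1)/Cor. 3.12 for the Θ-volume input OF INITIAL Θ-DATA must use arithmetic of the curve beyond the pilot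
valuations and the genuine local fields (in print: [IUTchIII] Thm. 3.11's multiradial algorithm; numerically: the conductor terms of
[IUTchIV] Thm. 1.10) — the genuine-completion analogue of TEAM A's interface-level `Cor312Vol.GapWitness.thm311_bridgeHyps_not_imp_statement`.
HONEST SCOPE: synthetic inhabitant of the input type (NOT initial Θ-data); nothing here says (1.1) fails for any actual initial Θ-data.
[cite: DupuyHilado2025, §1 (1.1), Def. 3.6.3, §3.9, Thm. 3.10.1] [cite: Mochizuki2012, IUTchIV Thm. 1.10 Steps (v)–(viii) p. 27–30]
[claim: Mochizuki2012, status: disputed] for every IUT quotation.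
-/

noncomputable section

open Set NumberField IsDedekindDomain Literature.IUT.LogVolume

namespace Summit.ABC.IUTFork

variable {F₀ : Type} [Field F₀] [NumberField F₀] {K : Type} [Field K] [NumberField K] [Algebra F₀ K]

namespace DHData

/-- The `p`-local `q`-mass `Q_p = deĝ̲(Σ_{v|p} P_q(v)[v])` of a Θ-volume input is nonnegative (`P_q` is effective).
[cite: DupuyHilado2025, §3.3] -/
theorem localQMass_nonneg (I : ThetaVolumeInput F₀ K) (p : ℕ) :
    0 ≤ FinDivisor.ndeg F₀ (∑ v : placesOver F₀ p, FinDivisor.of v.1 (I.X.qPilot v.1)) := by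
  classical
  refine FinDivisor.ndeg_nonneg fun w => ?_
  rw [Finsupp.finsetSum_apply]
  refine Finset.sum_nonneg fun v _ => ?_
  rw [Finsupp.single_apply]
  split_ifs
  · exact PrimePacket.qPilot_apply_nonneg I.X _
  · exact le_rfl

/-- **At ANY prime, `−|log(Θ)|_p ≤ δ_p(I)`** (drop the nonpositive `−c_l·Q_p`). [cite: Mochizuki2012, IUTchIV Thm. 1.10 Step (v) p. 27–28] -/
theorem negLogThetaLoc_le_explicitDeltaAt (I : ThetaVolumeInput F₀ K) {p : ℕ} (hp : p.Prime) :
    I.negLogThetaLoc p ≤ explicitDeltaAt I p := by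
  have h := negLogThetaLoc_le I hp
  have hQ := localQMass_nonneg I p
  have hc : (0 : ℝ) ≤ ((I.X.lstar : ℝ) + 1) * (2 * I.X.lstar + 1) / 6 := by positivity
  nlinarith

end DHData

namespace ThetaVolumeInput

variable (p : ℕ) [hp : Fact p.Prime] (l : ℕ) (hl : l.Prime) (h5 : 5 ≤ l)

/-- The support primes of the synthetic input do not depend on the depth `N`: the prime factors of `2·|disc K|` and `p`.
[cite: Mochizuki2012, IUTchIV Thm. 1.10 Step (vi) p. 29] -/
theorem deepAt_supportPrimes (N : ℕ) (hN : 0 < N) (σ : PlaceSection F₀ K) :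
    (deepAt p l hl h5 N hN σ).supportPrimes = (2 * (NumberField.discr K).natAbs).primeFactors ∪ (placesOver F₀ p).image (residueChar F₀) :=
  rfl

/-- The `ord(q)`-free per-prime constant `D_{p'}(I)` of `explicitDeltaAt_le_of_subsingleton`, as a total function of the prime
`p'` (value `0` at non-primes; the place over `p'` chosen by `placesOver_nonempty`): it depends on `I` only through `ℓ⋆` and the
section `σ` (the genuine completions), NOT through the pilot divisors. [cite: Mochizuki2012, IUTchIV Thm. 1.10 Step (v) p. 27–28] -/
def boundAt (I : ThetaVolumeInput F₀ K) (p' : ℕ) : ℝ :=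
  if hp' : p'.Prime then
    haveI : Fact p'.Prime := ⟨hp'⟩
    (((I.X.lstar : ℝ) + 3) / 2 * differentOrd p' ((I.σ.localFieldFamily p' hp').k
        ⟨(placesOver_nonempty F₀ p').choose, (placesOver_nonempty F₀ p').choose_spec⟩) + 1) * Real.log p'
      + ((I.X.lstar : ℝ) + 3) / 2 * (3 + Real.log (absRamificationIdx p' ((I.σ.localFieldFamily p' hp').k
        ⟨(placesOver_nonempty F₀ p').choose, (placesOver_nonempty F₀ p').choose_spec⟩)))
  else 0

/-- **Over a degree-one base, `−|log(Θ)|_{p'} ≤ D_{p'}(I)` at every prime `p'`, for EVERY Θ-volume input.**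
[cite: Mochizuki2012, IUTchIV Thm. 1.10 Step (v) p. 27–28] -/
theorem negLogThetaLoc_le_boundAt (hF : Module.finrank ℚ F₀ = 1) (I : ThetaVolumeInput F₀ K) {p' : ℕ} (hp' : p'.Prime) :
    I.negLogThetaLoc p' ≤ boundAt I p' := by
  haveI : Fact p'.Prime := ⟨hp'⟩
  rw [boundAt, dif_pos hp']
  exact (DHData.negLogThetaLoc_le_explicitDeltaAt I hp').trans
    (DHData.explicitDeltaAt_le_of_subsingleton I (ValLine.placesOver_subsingleton_of_finrank_eq_one hF p')
      ⟨(placesOver_nonempty F₀ p').choose, (placesOver_nonempty F₀ p').choose_spec⟩)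

/-- The bound for the synthetic input does not depend on the depth `N` (definitional: `ℓ⋆ = (l−1)/2`, same `σ`).
[cite: DupuyHilado2025, §3.3] -/
theorem boundAt_deepAt_eq (N N' : ℕ) (hN : 0 < N) (hN' : 0 < N') (σ : PlaceSection F₀ K) (p' : ℕ) :
    boundAt (deepAt p l hl h5 N hN σ) p' = boundAt (deepAt p l hl h5 N' hN' σ) p' := rfl

/-- The `q`-pilot of the synthetic input over a degree-one base: `−|log(q)| = −N·e_{v₀}·ln N(v₀)` (`v₀` the place over `p`).
[cite: DupuyHilado2025, §3.3, Thm. 3.10.1] -/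
theorem deepAt_negAbsLogQ (hF : Module.finrank ℚ F₀ = 1) (N : ℕ) (hN : 0 < N) (σ : PlaceSection F₀ K) (v₀ : placesOver F₀ p) :
    (deepAt p l hl h5 N hN σ).negAbsLogQ = -((N : ℝ) * ramIdx F₀ v₀.1 * logNorm F₀ v₀.1) := by
  have hp1 := ValLine.placesOver_subsingleton_of_finrank_eq_one hF p
  rw [ThetaVolumeInput.negAbsLogQ]
  show -FinDivisor.ndeg F₀ (∑ w ∈ placesOver F₀ p,
    FinDivisor.of w (((PilotData.deepAt F₀ p l hl h5 N hN).ordq w : ℝ) / (2 * (l : ℕ)))) = _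
  rw [Finset.sum_eq_single_of_mem v₀.1 v₀.2 fun b hb hne => absurd (congrArg Subtype.val (hp1 ⟨b, hb⟩ v₀)) hne,
    FinDivisor.ndeg_of, PilotData.deepAt_ordq p l hl h5 N hN v₀.1 v₀.2, hF]
  have hl0 : (l : ℝ) ≠ 0 := by exact_mod_cast hl.ne_zero
  push_cast
  field_simp

/-- The `p`-local `q`-mass of the synthetic input over a degree-one base: `Q_p = N·e_{v₀}·ln N(v₀)`. [cite: DupuyHilado2025, §3.3] -/
theorem deepAt_localQMass (hF : Module.finrank ℚ F₀ = 1) (N : ℕ) (hN : 0 < N) (σ : PlaceSection F₀ K) (v₀ : placesOver F₀ p) :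
    FinDivisor.ndeg F₀ (∑ v : placesOver F₀ p, FinDivisor.of v.1 ((deepAt p l hl h5 N hN σ).X.qPilot v.1)) =
      (N : ℝ) * ramIdx F₀ v₀.1 * logNorm F₀ v₀.1 := by
  have hp1 := ValLine.placesOver_subsingleton_of_finrank_eq_one hF p
  rw [DHData.localQMass_eq_of_subsingleton _ hp1 v₀, DHData.qPilot_apply_of_mem _ v₀.2, hF]
  show (((PilotData.deepAt F₀ p l hl h5 N hN).ordq v₀.1 : ℝ) / (2 * (l : ℕ))) * logNorm F₀ v₀.1 / ((1 : ℕ) : ℝ) = _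
  rw [PilotData.deepAt_ordq p l hl h5 N hN v₀.1 v₀.2]
  have hl0 : (l : ℝ) ≠ 0 := by exact_mod_cast hl.ne_zero
  push_cast
  field_simp

/-- **THE CLAIM-FORM `Cor312Of` IS NOT A CONSEQUENCE OF THE VOLUME FORMALISM: it FAILS for the synthetic input of large depth.**
For every number field `K` over a degree-one base `F₀`, every section `σ`, every prime `p` and prime `l ≥ 5` there is a depth `N` with
`¬ (deepAt p l N σ).Cor312Of`, i.e. `−|log(Θ)| < −|log(q)|` for the DEFINED genuine-completion log-volumes of abc-iut-S2's
`GenuineLogTheta` at the synthetic pilot data `j_E = p^{−2lN}`, `S = V(F₀)_p` (hence also `¬ Cor312NonarchOf`, the Dupuy–Hilado form).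
HONEST SCOPE: the input is SYNTHETIC (one deep bad prime, no compensating conductor — impossible for the Θ-volume input of actual
initial Θ-data only inasmuch as abc/Szpiro-type balance holds for elliptic curves); nothing here says (1.1)/Cor. 3.12 fails for initial
Θ-data; no side taken. [cite: DupuyHilado2025, §1 (1.1), Thm. 3.10.1] [cite: Mochizuki2012, IUTchIV Thm. 1.10 Steps (v)–(viii) p. 27–30]
[claim: Mochizuki2012, status: disputed] -/
theorem exists_deepAt_not_cor312Of (hF : Module.finrank ℚ F₀ = 1) (σ : PlaceSection F₀ K) :
    ∃ (N : ℕ) (hN : 0 < N), ¬ (deepAt p l hl h5 N hN σ).Cor312Of := by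
  obtain ⟨w, hw⟩ := placesOver_nonempty F₀ p
  let v₀ : placesOver F₀ p := ⟨w, hw⟩
  have hp1 := ValLine.placesOver_subsingleton_of_finrank_eq_one hF p
  -- the `N`-free data: support primes `T`, the per-prime constants, the slope
  set T : Finset ℕ := (2 * (NumberField.discr K).natAbs).primeFactors ∪ (placesOver F₀ p).image (residueChar F₀) with hT
  set I₁ := deepAt p l hl h5 1 Nat.one_pos σ with hI₁
  set C : ℝ := ∑ p' ∈ T, boundAt I₁ p' + ThetaVolumeInput.archLogTheta l with hC
  set L : ℕ := (l - 1) / 2 with hL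
  set A : ℝ := ((((L : ℝ) + 1) * (2 * L + 1) / 6) - 1) * (ramIdx F₀ w * logNorm F₀ w) with hA
  have hL2 : (2 : ℝ) ≤ L := by exact_mod_cast I₁.X.two_le_lstar
  have he : (0 : ℝ) < ramIdx F₀ w := by exact_mod_cast Nat.pos_of_ne_zero (ramIdx_ne_zero F₀ w)
  have hln : 0 < logNorm F₀ w := logNorm_pos F₀ w
  have hApos : 0 < A := by
    have h3 : (0 : ℝ) < (((L : ℝ) + 1) * (2 * L + 1) / 6) - 1 := by nlinarith
    positivity
  obtain ⟨N, hN⟩ := exists_nat_gt (C / A)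
  refine ⟨N + 1, Nat.succ_pos N, fun h312 => ?_⟩
  set I := deepAt p l hl h5 (N + 1) (Nat.succ_pos N) σ with hI
  have hpT : p ∈ I.supportPrimes := by
    have := I.residueChar_mem_supportPrimes (v := w) hw
    rwa [(mem_placesOver_iff_residueChar w).mp hw] at this
  -- per-prime bounds
  have hQ : FinDivisor.ndeg F₀ (∑ v : placesOver F₀ p, FinDivisor.of v.1 (I.X.qPilot v.1)) =
      ((N + 1 : ℕ) : ℝ) * ramIdx F₀ w * logNorm F₀ w := deepAt_localQMass p l hl h5 hF (N + 1) (Nat.succ_pos N) σ v₀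
  have hθp : I.negLogThetaLoc p ≤ -((((L : ℝ) + 1) * (2 * L + 1) / 6) * (((N + 1 : ℕ) : ℝ) * ramIdx F₀ w * logNorm F₀ w))
      + boundAt I p := by
    have h1 := DHData.negLogThetaLoc_le I hp.out
    have h2 := DHData.explicitDeltaAt_le_of_subsingleton I hp1
      ⟨(placesOver_nonempty F₀ p).choose, (placesOver_nonempty F₀ p).choose_spec⟩
    rw [hQ] at h1
    rw [boundAt, dif_pos hp.out]
    have hLI : (I.X.lstar : ℝ) = L := by rw [show I.X.lstar = L from rfl]
    simp only [hLI] at h1 h2 ⊢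
    linarith
  have hothers : ∀ p' ∈ I.supportPrimes.erase p, I.negLogThetaLoc p' ≤ boundAt I p' := fun p' hp' =>
    negLogThetaLoc_le_boundAt hF I (I.prime_of_mem_supportPrimes (Finset.mem_of_mem_erase hp'))
  -- the nonarchimedean sum
  have hsum : I.negLogThetaNonarch ≤ (∑ p' ∈ I.supportPrimes, boundAt I p')
      - (((L : ℝ) + 1) * (2 * L + 1) / 6) * (((N + 1 : ℕ) : ℝ) * ramIdx F₀ w * logNorm F₀ w) := by
    rw [ThetaVolumeInput.negLogThetaNonarch, ← Finset.add_sum_erase _ _ hpT, ← Finset.add_sum_erase _ (boundAt I) hpT]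
    have := Finset.sum_le_sum hothers
    linarith
  -- everything is `N`-free except the two linear terms
  have hTI : I.supportPrimes = T := rfl
  have hbound : (∑ p' ∈ I.supportPrimes, boundAt I p') = ∑ p' ∈ T, boundAt I₁ p' := by
    rw [hTI]
    exact Finset.sum_congr rfl fun p' _ => boundAt_deepAt_eq p l hl h5 (N + 1) 1 (Nat.succ_pos N) Nat.one_pos σ p'
  have hq : I.negAbsLogQ = -(((N + 1 : ℕ) : ℝ) * ramIdx F₀ w * logNorm F₀ w) :=
    deepAt_negAbsLogQ p l hl h5 hF (N + 1) (Nat.succ_pos N) σ v₀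
  -- unfold the claim form and conclude
  have h312' : I.negAbsLogQ ≤ I.negLogThetaNonarch + ThetaVolumeInput.archLogTheta l := h312
  rw [hq] at h312'
  rw [hbound] at hsum
  have hkey : C < A * ((N : ℝ) + 1) := by
    have h1 : C < A * N := ((div_lt_iff₀ hApos).mp hN).trans_eq (mul_comm _ _)
    nlinarith
  have hcast : (((N + 1 : ℕ) : ℝ)) = (N : ℝ) + 1 := by push_cast; ring
  rw [hcast] at h312' hsum
  rw [hA] at hkey
  rw [hC] at hkey
  nlinarith

end ThetaVolumeInput

end Summit.ABC.IUTFork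

end
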